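import Summits.PneNP.PneNP.Theorems.KarlinRubinMonotoneBlindDnfPlanted
import Summits.PneNP.PneNP.Theorems.KarlinRubinMonotoneBlindCoverCompleteness

/-!
# Crux `MonotoneBlind` (stmt-PneNP-18027, route KarlinRubin), line `Sketch`: stub `stub_resampling`

The general WITNESS / RESAMPLING inequality of line `Sketch` (witness / hinge form) of crux
stmt-PneNP-18027. For a planted set `A` and noises `x, x' : EdgeVec n` write `mix A x x'` for the edge
vector that agrees with `x'` on the slots inside `A` and with `x` elsewhere
(`fun e => if (∀ v ∈ e, v ∈ A) then x' e else x e`), and let the FIBRE DENSITY of a test `f` at `(x, A)` be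
`dens_f(x, A) = Pr_{x' ∼ G(n,1/2)}[f (mix A x x') = 1]`. Then for every `n k`, every test
`f : EdgeVec n → Bool` (no monotonicity, no circuit, no size bound) and every level `η : ℝ≥0∞`:

  `Pr_{G(n,1/2,k)}[f = 1] ≤ (#kSubsets)⁻¹ Σ_A Pr_x[f (plant A x) = 1 ∧ dens_f(x, A) ≤ η] + η⁻¹ · Pr_{G(n,1/2)}[f = 1]`

(`stub_resampling`: planted acceptance `≤` hinge mass at level `η` `+ η⁻¹ ·` null acceptance).

Proof. Fibre the planted law over `A` (`plantedCliqueDist_toOuterMeasure_eq_sum`); for a fixed `A`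
split the acceptance event by `dens ≤ η`, bound `Pr_x[η < dens_f(x, A)]` by Markov
(`erdosRenyiHalf_markov`) and use the exact identity `E_x[dens_f(x, A)] = Pr_{G(n,1/2)}[f = 1]`
(`resampling_tsum_density_eq`): the swap `(x, x') ↦ (mix A x x', mix A x' x)` is an involution of
`EdgeVec n × EdgeVec n`, so `mix A x x'` is uniform for `x, x'` independent uniform
(`resampling_sum_sum_eq`). The degenerate levels `η = 0` (`η⁻¹ = ⊤`; if the null acceptance vanishes
then every fibre density vanishes, every noise having positive mass) and `η = ⊤` are treated directly
(`resampling_markov_split`).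

* `resampling_sum_sum_eq` — `Σ_x Σ_{x'} g (x' on p, x off p) = #(EdgeVec n) · Σ_x g x` for any selector
  `p` of slots and any `g : EdgeVec n → ℝ≥0∞`;
* `resampling_tsum_density_eq` — `Σ' x, Pr[x] · Pr_{x'}[f (x' on p, x off p) = 1] = Pr[f = 1]`;
* `resampling_markov_split` — `Pr[S] ≤ Pr[S ∧ g ≤ η] + η⁻¹ · Pr[T]` whenever `E[g] ≤ Pr[T]`, for ALL `η`;
* `resampling_plant_le` — the inequality for one planted set `A`;
* `stub_resampling` — the registered stub (average over `A ∈ kSubsets n k`).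

All `--supports stmt-PneNP-18027`; no definitions.
-/

set_option linter.dupNamespace false -- `Summit.PneNP.PneNP.…` is the layout-mandated namespace

namespace Summit.PneNP.PneNP.Theorems.MonotoneBlind.VertexCover

open Literature.Computability.Complexity Literature.Probability.RandomGraphs.PlantedClique Filter Finset
open scoped ENNReal Topology Classical

variable {n : ℕ}

/-! ### Resampling a set of slots preserves the uniform law -/

/-- **Resampling is measure preserving (counting form).** For any selector `p` of slots and any
`g : EdgeVec n → ℝ≥0∞`: `Σ_x Σ_{x'} g (x' on p, x off p) = #(EdgeVec n) · Σ_x g x`. The swap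
`(x, x') ↦ ((x' on p, x off p), (x on p, x' off p))` is an involution of `EdgeVec n × EdgeVec n` whose
first coordinate is the resampled vector. [folklore] -/
theorem resampling_sum_sum_eq {p : (⊤ : SimpleGraph (Fin n)).edgeSet → Prop} {_ : DecidablePred p}
    (g : EdgeVec n → ℝ≥0∞) :
    ∑ x : EdgeVec n, ∑ x' : EdgeVec n, g (fun e => if p e then x' e else x e) =
      (Fintype.card (EdgeVec n) : ℝ≥0∞) * ∑ x : EdgeVec n, g x := by
  -- the swap of the slots selected by `p` is an involution of pairs of noises
  have hσ : Function.Involutive fun q : EdgeVec n × EdgeVec n =>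
      ((fun e => if p e then q.2 e else q.1 e), (fun e => if p e then q.1 e else q.2 e)) := by
    intro q
    refine Prod.ext ?_ ?_ <;> funext e <;> dsimp only <;> split_ifs <;> rfl
  calc ∑ x : EdgeVec n, ∑ x' : EdgeVec n, g (fun e => if p e then x' e else x e)
      = ∑ q : EdgeVec n × EdgeVec n, g (fun e => if p e then q.2 e else q.1 e) :=
        (Fintype.sum_prod_type' fun x x' : EdgeVec n => g (fun e => if p e then x' e else x e)).symm
    _ = ∑ q : EdgeVec n × EdgeVec n, g q.1 := by
        refine Fintype.sum_bijective _ hσ.bijective _ _ fun q => ?_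
        rfl
    _ = ∑ x : EdgeVec n, ∑ _x' : EdgeVec n, g x :=
        Fintype.sum_prod_type' fun (x : EdgeVec n) (_ : EdgeVec n) => g x
    _ = (Fintype.card (EdgeVec n) : ℝ≥0∞) * ∑ x : EdgeVec n, g x := by
        rw [mul_sum]
        exact sum_congr rfl fun x _ => by rw [sum_const, card_univ, nsmul_eq_mul]

/-- **The noise-average of the fibre density is the null acceptance.** For every selector `p` of
slots and every test `f`: `Σ' x, Pr[x] · Pr_{x'}[f (x' on p, x off p) = 1] = Pr_{G(n,1/2)}[f = 1]`
(resampling a set of slots of a uniform point with an independent uniform point gives a uniform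
point). [folklore] -/
theorem resampling_tsum_density_eq {p : (⊤ : SimpleGraph (Fin n)).edgeSet → Prop}
    {_ : DecidablePred p} (f : EdgeVec n → Bool) :
    ∑' x, erdosRenyiHalf n x *
        (erdosRenyiHalf n).toOuterMeasure {x' | f (fun e => if p e then x' e else x e) = true} =
      (erdosRenyiHalf n).toOuterMeasure {x | f x = true} := by
  have hN0 : (Fintype.card (EdgeVec n) : ℝ≥0∞) ≠ 0 := Nat.cast_ne_zero.2 Fintype.card_ne_zero
  have hNtop : (Fintype.card (EdgeVec n) : ℝ≥0∞) ≠ ⊤ := ENNReal.natCast_ne_top _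
  have happ : ∀ x : EdgeVec n, erdosRenyiHalf n x = (Fintype.card (EdgeVec n) : ℝ≥0∞)⁻¹ :=
    fun x => by rw [erdosRenyiHalf, PMF.uniformOfFintype_apply]
  -- the indicator of an acceptance set against the uniform weights
  have hind : ∀ (g : EdgeVec n → Bool) (z : EdgeVec n),
      {y | g y = true}.indicator (erdosRenyiHalf n) z =
        cond (g z) (Fintype.card (EdgeVec n) : ℝ≥0∞)⁻¹ 0 := by
    intro g z
    by_cases h : g z = true
    · rw [Set.indicator_of_mem (show z ∈ {y | g y = true} from h), happ, h, cond_true]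
    · rw [Set.indicator_of_notMem (show z ∉ {y | g y = true} from h), eq_false_of_ne_true h,
        cond_false]
  simp only [tsum_fintype, PMF.toOuterMeasure_apply_fintype, hind, happ]
  rw [← mul_sum, resampling_sum_sum_eq (p := p)
      (fun z => cond (f z) (Fintype.card (EdgeVec n) : ℝ≥0∞)⁻¹ 0),
    ← mul_assoc, ENNReal.inv_mul_cancel hN0 hNtop, one_mul]

/-! ### The Markov split at an arbitrary level -/

/-- **Markov split.** For every event `{x | s x}`, statistic `g : EdgeVec n → ℝ≥0∞` with
`Σ' x, Pr[x] · g x ≤ Pr[T]`, and EVERY level `η : ℝ≥0∞` (including the degenerate `η = 0`, where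
`η⁻¹ = ⊤`, and `η = ⊤`): `Pr[s] ≤ Pr[s ∧ g ≤ η] + η⁻¹ · Pr[T]`. For `0 < η < ⊤` this is
`{s} ⊆ {s ∧ g ≤ η} ∪ {η < g}` and Markov's inequality under `G(n,1/2)`. [folklore] -/
theorem resampling_markov_split (s : EdgeVec n → Prop) (T : Set (EdgeVec n)) (g : EdgeVec n → ℝ≥0∞)
    (η : ℝ≥0∞) (hg : ∑' x, erdosRenyiHalf n x * g x ≤ (erdosRenyiHalf n).toOuterMeasure T) :
    (erdosRenyiHalf n).toOuterMeasure {x | s x} ≤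
      (erdosRenyiHalf n).toOuterMeasure {x | s x ∧ g x ≤ η} +
        η⁻¹ * (erdosRenyiHalf n).toOuterMeasure T := by
  rcases eq_or_ne η ⊤ with rfl | hηtop
  · refine le_trans ((erdosRenyiHalf n).toOuterMeasure.mono fun x hx => ?_) le_self_add
    exact ⟨hx, le_top⟩
  rcases eq_or_ne η 0 with rfl | hη0
  · by_cases hT : (erdosRenyiHalf n).toOuterMeasure T = 0
    · -- `E[g] = 0`, so `g ≡ 0` (every noise has positive mass): the hinge event is all of `{s}`
      rw [hT, nonpos_iff_eq_zero, ENNReal.tsum_eq_zero] at hg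
      have hg0 : ∀ x, g x = 0 := fun x => by
        refine (mul_eq_zero.1 (hg x)).resolve_left ?_
        rw [erdosRenyiHalf, PMF.uniformOfFintype_apply]
        exact ENNReal.inv_ne_zero.2 (ENNReal.natCast_ne_top _)
      refine le_trans ((erdosRenyiHalf n).toOuterMeasure.mono fun x hx => ?_) le_self_add
      exact ⟨hx, (hg0 x).le⟩
    · rw [ENNReal.inv_zero, ENNReal.top_mul hT]
      exact le_add_left le_top
  calc (erdosRenyiHalf n).toOuterMeasure {x | s x}
      ≤ (erdosRenyiHalf n).toOuterMeasure ({x | s x ∧ g x ≤ η} ∪ {x | η < g x}) := by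
        refine (erdosRenyiHalf n).toOuterMeasure.mono fun x hx => ?_
        by_cases h : g x ≤ η
        · exact Or.inl ⟨hx, h⟩
        · exact Or.inr (not_le.1 h)
    _ ≤ (erdosRenyiHalf n).toOuterMeasure {x | s x ∧ g x ≤ η} +
          (erdosRenyiHalf n).toOuterMeasure {x | η < g x} := MeasureTheory.measure_union_le _ _
    _ ≤ (erdosRenyiHalf n).toOuterMeasure {x | s x ∧ g x ≤ η} +
          η⁻¹ * ∑' x, erdosRenyiHalf n x * g x :=
        add_le_add le_rfl (erdosRenyiHalf_markov g hη0 hηtop)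
    _ ≤ (erdosRenyiHalf n).toOuterMeasure {x | s x ∧ g x ≤ η} +
          η⁻¹ * (erdosRenyiHalf n).toOuterMeasure T := add_le_add le_rfl (mul_le_mul' le_rfl hg)

/-! ### The resampling inequality -/

/-- **The resampling inequality for one planted set.** For every `A`, test `f` and level `η`:
`Pr_x[f (plant A x) = 1] ≤ Pr_x[f (plant A x) = 1 ∧ dens_f(x, A) ≤ η] + η⁻¹ · Pr_{G(n,1/2)}[f = 1]`,
`dens_f(x, A) = Pr_{x'}[f (x' inside A, x outside A) = 1]`. [folklore] -/
theorem resampling_plant_le (A : Finset (Fin n)) (f : EdgeVec n → Bool) (η : ℝ≥0∞) :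
    (erdosRenyiHalf n).toOuterMeasure {x | f (plant A x) = true} ≤
      (erdosRenyiHalf n).toOuterMeasure {x | f (plant A x) = true ∧
          (erdosRenyiHalf n).toOuterMeasure
            {x' | f (fun e => if (∀ v ∈ (e : Sym2 (Fin n)), v ∈ A) then x' e else x e) = true} ≤ η} +
        η⁻¹ * (erdosRenyiHalf n).toOuterMeasure {x | f x = true} :=
  resampling_markov_split (fun x => f (plant A x) = true) {x | f x = true}
    (fun x => (erdosRenyiHalf n).toOuterMeasure
      {x' | f (fun e => if (∀ v ∈ (e : Sym2 (Fin n)), v ∈ A) then x' e else x e) = true})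
    η (resampling_tsum_density_eq f).le

/-- **stub_resampling** (the general witness / resampling inequality — no monotonicity, no size).
For every `n k`, every test `f : EdgeVec n → Bool` and every level `η : ℝ≥0∞`:
`Pr_{G(n,1/2,k)}[f = 1] ≤ (#kSubsets)⁻¹ Σ_A Pr_x[f (plant A x) = 1 ∧ dens_f(x, A) ≤ η] + η⁻¹ · Pr_{G(n,1/2)}[f = 1]`,
`dens_f(x, A) = Pr_{x'}[f (x outside A, x' inside A) = 1]`. Proof: fibre the planted law over `A`
(`plantedCliqueDist_toOuterMeasure_eq_sum`), apply `resampling_plant_le` in each fibre (Markov and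
the identity `E_x[dens_f(x, A)] = Pr_x[f x = 1]`), and average. [folklore] -/
theorem stub_resampling :
    ∀ (n k : ℕ) (f : EdgeVec n → Bool) (η : ℝ≥0∞),
      (plantedCliqueDist n k).toOuterMeasure {y | f y = true} ≤
        ((#(kSubsets n k) : ℕ) : ℝ≥0∞)⁻¹ *
            ∑ A ∈ kSubsets n k, (erdosRenyiHalf n).toOuterMeasure
              {x | f (plant A x) = true ∧
                (erdosRenyiHalf n).toOuterMeasure
                  {x' | f (fun e => if (∀ v ∈ (e : Sym2 (Fin n)), v ∈ A) then x' e else x e) = true} ≤ η} +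
          η⁻¹ * (erdosRenyiHalf n).toOuterMeasure {x | f x = true} := by
  intro n k f η
  have hne := card_kSubsets_cast_ne_zero n k
  have htop : ((#(kSubsets n k) : ℕ) : ℝ≥0∞) ≠ ⊤ := ENNReal.natCast_ne_top _
  rw [plantedCliqueDist_toOuterMeasure_eq_sum]
  calc ((#(kSubsets n k) : ℕ) : ℝ≥0∞)⁻¹ *
        ∑ A ∈ kSubsets n k, (erdosRenyiHalf n).toOuterMeasure {x | plant A x ∈ {y : EdgeVec n | f y = true}}
      ≤ ((#(kSubsets n k) : ℕ) : ℝ≥0∞)⁻¹ *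
          ∑ A ∈ kSubsets n k, ((erdosRenyiHalf n).toOuterMeasure
              {x | f (plant A x) = true ∧
                (erdosRenyiHalf n).toOuterMeasure
                  {x' | f (fun e => if (∀ v ∈ (e : Sym2 (Fin n)), v ∈ A) then x' e else x e) = true} ≤ η} +
            η⁻¹ * (erdosRenyiHalf n).toOuterMeasure {x | f x = true}) := by
        gcongr with A
        exact resampling_plant_le A f η
    _ = ((#(kSubsets n k) : ℕ) : ℝ≥0∞)⁻¹ *
            ∑ A ∈ kSubsets n k, (erdosRenyiHalf n).toOuterMeasure
              {x | f (plant A x) = true ∧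
                (erdosRenyiHalf n).toOuterMeasure
                  {x' | f (fun e => if (∀ v ∈ (e : Sym2 (Fin n)), v ∈ A) then x' e else x e) = true} ≤ η} +
          η⁻¹ * (erdosRenyiHalf n).toOuterMeasure {x | f x = true} := by
        rw [sum_add_distrib, sum_const, nsmul_eq_mul, mul_add,
          ← mul_assoc _ ((#(kSubsets n k) : ℕ) : ℝ≥0∞) _, ENNReal.inv_mul_cancel hne htop, one_mul]

end Summit.PneNP.PneNP.Theorems.MonotoneBlind.VertexCover
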